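import Literature.NumberTheory.Transcendental.KZFibredRelations
import Literature.NumberTheory.Transcendental.KZDominatedFamily
import Literature.NumberTheory.Transcendental.KZKernelConjectureForms
import Summits.KontsevichZagierPeriods.KontsevichZagierPeriods.Theses.ValuedFieldSpecialisation
import Summits.KontsevichZagierPeriods.KontsevichZagierPeriods.Theorems.ValuedFieldSpecialisationParametricLiftingSliceValueElementaryFamily
import Summits.KontsevichZagierPeriods.KontsevichZagierPeriods.Theorems.ValuedFieldSpecialisationParametricLiftingDivergentMonomialsCoeff
import Summits.KontsevichZagierPeriods.KontsevichZagierPeriods.Theorems.ValuedFieldSpecialisationParametricLiftingDivergentNetVanishes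
import Summits.KontsevichZagierPeriods.KontsevichZagierPeriods.Theorems.ValuedFieldSpecialisationParametricLiftingElementaryNetFibred
import Summits.KontsevichZagierPeriods.KontsevichZagierPeriods.Theorems.ValuedFieldSpecialisationParametricLiftingStrength
import Summits.KontsevichZagierPeriods.KontsevichZagierPeriods.Theorems.ValuedFieldSpecialisationParametricLiftingKernelForm
import Summits.KontsevichZagierPeriods.KontsevichZagierPeriods.Theorems.ValuedFieldSpecialisationParametricLiftingExistsDimBound
import Summits.KontsevichZagierPeriods.KontsevichZagierPeriods.Theorems.ValuedFieldSpecialisationParametricLiftingEvalCoefficientClassEqZero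
import Summits.KontsevichZagierPeriods.KontsevichZagierPeriods.Theorems.ReducedPeriodRing.Negative.DimZero

/-!
# Route ValuedFieldSpecialisation — crux `ParametricLifting` (stmt-KontsevichZagierPeriods-3498):
# THE GRADED BOOTSTRAP (lead c7)

Helper (`--supports`) for item stmt-KontsevichZagierPeriods-3498, line `registered` as reshaped by
dimension grading (skeleton `Cruxes/ParametricLifting/Lines/birth.lean`, lead c7). The registered birth
composition "regularise, then remove the resonances" died because its resonance-removal stub S3b (the
coefficient classes of a slice-null elementary divergent net are relations) is EQUIVALENT to the kernel
conjecture: the coefficient representations range over all dimensions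
(`coefficientClasses_mem_relations_iff_kzKernelConjecture`). This file proves that ONE extra clause — the
divergent coefficients live one dimension below the combination being certified (the weight drop of every
regularised identity in print) — turns the composition into an honest strong induction on dimension.

Write (all inlined in the theorem types, no definition is introduced):
* level `E` := `AddSubgroup.closure {[r] | dim r < E}` ⊆ `KZ.FormalRep`;
* **RLG** (graded regularised lifting, kernel form) := for every `E` and every `x` on level `E` with
  `KZ.eval x = 0` there is `H ∈ KZ.fibredRelations`, `H = Σ mᵢ [Pᵢ] + Σ m₂ⱼ [Rⱼ]`, the `Pᵢ` ELEMENTARY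
  DIVERGENT PRODUCTS over coefficient representations `ρᵢ` of dimension `dᵢ`, `dᵢ + 1 < E`, the `Rⱼ`
  DOMINATED with special fibres `r₀ⱼ`, and `Σ m₂ⱼ [r₀ⱼ] − x ∈ KZ.relations`;
* **SF** (special-fibre rigidity) := special-fibre classes of dominated fibred relations are relations.

Results:
* `kzKernel_dimLevel_of_regLiftGraded_of_specialFibre` — **RLG ∧ SF ⇒ the kernel conjecture on every
  level**, by induction on `E`: S2 (landed `stub_divergentNetVanishes_of` with S2a/S2b) kills the slices
  of the divergent part, its coefficient classes have value `0` (`stub_eval_coefficientClass_eq_zero`) and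
  lie one level down, hence are relations by the induction hypothesis, so the divergent part is a fibred
  relation (S3a, `stub_elementaryNet_mem_fibredRelations`), the dominated net `N = H − D` is a fibred
  relation, and SF certifies its special fibre `≡ x`;
* `kzKernelConjecture_of_regLiftGraded_of_specialFibre`, `kontsevichZagierPeriods_of_…`,
  `parametricLifting_of_…` — with `stub_exists_dimBound` (every `x` lies on some level);
* `kontsevichZagierPeriods_of_ctConstruction_of_regLiftGraded` — **the route's assembly with the open
  core weakened from `ParametricLifting` to RLG** (`CTConstruction ⇒ SF` is `specialFibre_of_ctConstruction`);
* strength: `regLiftGraded_of_parametricLifting` (**PL ⇒ RLG**, via the kernel form of PL, empty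
  divergent part) and `regLiftGraded_of_kzKernelConjecture`; hence
  `kzKernelConjecture_iff_regLiftGraded_and_specialFibre` and
  `kontsevichZagierPeriods_iff_regLiftGraded_and_specialFibre` — the split is lossless, and neither
  half is known to be summit-equivalent;
* calibration: `regLiftGraded_of_le_one` — RLG holds unconditionally on levels `E ≤ 1` (constants:
  `dimZero_kernel`); the open content starts at level `2` (one-dimensional periods).

Sources: M. Kontsevich, D. Zagier, *Periods* (2001), §1.2, Conjecture 1; A. Huber, S. Müller-Stach,
*Periods and Nori Motives* (2017), Conj. 13.2.1 (kernel form); K. Ihara, M. Kaneko, D. Zagier,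
*Derivation and double shuffle relations for multiple zeta values*, Compos. Math. 142 (2006) (the
weight drop of regularised double shuffle, the model for the grading clause). The fibred/dominated/
elementary vocabulary is this route's (`KZFibredRelations.lean`, `KZDominatedFamily.lean`, crux
`ClassLevelExpansion`).
-/

noncomputable section

namespace Summit.KontsevichZagierPeriods.ValuedFieldSpecialisation

open MeasureTheory Set Filter
open scoped Topology
open Literature.NumberTheory.Transcendental
open Summit.KontsevichZagierPeriods.KontsevichZagierPeriods.Theses.ValuedFieldSpecialisation
  (ParametricLifting CTConstruction)

/-- **RLG ∧ SF ⇒ the kernel conjecture level by level.** If every vanishing formal combination on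
level `E` is the special fibre of a fibred relation whose divergent part is elementary with coefficients
on level `E − 1` (RLG) and special fibres of dominated fibred relations are relations (SF), then for every
`E`, every `x` on level `E` with `KZ.eval x = 0` lies in `KZ.relations`. Induction on `E` (level `0` is
`⊥`); the step: RLG at `E + 1`; the slices of the divergent part vanish (`stub_divergentNetVanishes_of`,
`stub_sliceValue_elementaryFamily`, `stub_divergentMonomials_coeff_eq_zero`); its coefficient classes have
value `0` (`stub_eval_coefficientClass_eq_zero`) and lie on level `E`, so are relations by the induction
hypothesis; the divergent part is then a fibred relation (`stub_elementaryNet_mem_fibredRelations`), so is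
`N = H − D`, and SF concludes. [Kontsevich–Zagier 2001, §1.2 Conjecture 1] [folklore] -/
theorem kzKernel_dimLevel_of_regLiftGraded_of_specialFibre
    (hRL : ∀ (E : ℕ) (x : KZ.FormalRep), x ∈ AddSubgroup.closure {y : KZ.FormalRep | ∃ (n : ℕ) (r : KZ.IntegralRep n), n < E ∧ y = KZ.of r} → KZ.eval x = 0 → ∃ H ∈ KZ.fibredRelations, ∃ (k : ℕ) (m : Fin k → ℤ) (p q b d : Fin k → ℕ) (ρ : (i : Fin k) → KZ.IntegralRep (d i)) (P : (i : Fin k) → KZ.IntegralRep (b i + d i + 1 + 1)) (k₂ : ℕ) (d₂ : Fin k₂ → ℕ) (m₂ : Fin k₂ → ℤ) (R : (j : Fin k₂) → KZ.IntegralRep (d₂ j + 1)) (r₀ g : (j : Fin k₂) → KZ.IntegralRep (d₂ j)), (∀ i, 0 < q i ∧ p i < q i ∧ (0 < p i ∨ 0 < b i) ∧ d i + 1 < E ∧ (P i).domain = {z | ∃ (s u : ℝ) (y : Fin (b i) → ℝ) (w : Fin (d i) → ℝ), z = Matrix.vecCons s (Matrix.vecCons u (Fin.append y w)) ∧ 0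 < s ∧ s < 1 ∧ 0 < u ∧ u ^ (q i) * s ^ (p i) < 1 ∧ (∀ j, s ≤ y j ∧ y j ≤ 1) ∧ w ∈ (ρ i).domain} ∧ (P i).integrand = fun z => (∏ j : Fin (b i), (z (Fin.castAdd (d i) j).succ.succ)⁻¹) * (ρ i).integrand (fun l : Fin (d i) => z (Fin.natAdd (b i) l).succ.succ)) ∧ (∀ j, KZ.IsDominatedFamily (R j) (r₀ j) (g j)) ∧ H = (∑ i, m i • KZ.of (P i)) + (∑ j, m₂ j • KZ.of (R j)) ∧ (∑ j, m₂ j • KZ.of (r₀ j)) - x ∈ KZ.relations)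
    (hSF : ∀ (k : ℕ) (d : Fin k → ℕ) (m : Fin k → ℤ) (R : (i : Fin k) → KZ.IntegralRep (d i + 1)) (r₀ g : (i : Fin k) → KZ.IntegralRep (d i)), (∀ i, KZ.IsDominatedFamily (R i) (r₀ i) (g i)) → (∑ i, m i • KZ.of (R i)) ∈ KZ.fibredRelations → (∑ i, m i • KZ.of (r₀ i)) ∈ KZ.relations) :
    ∀ (E : ℕ) (x : KZ.FormalRep), x ∈ AddSubgroup.closure {y : KZ.FormalRep | ∃ (n : ℕ) (r : KZ.IntegralRep n), n < E ∧ y = KZ.of r} → KZ.eval x = 0 → x ∈ KZ.relations := by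
  intro E
  induction E with
  | zero =>
    intro x hx _
    have hempty : {y : KZ.FormalRep | ∃ (n : ℕ) (r : KZ.IntegralRep n), n < 0 ∧ y = KZ.of r} = ∅ := by
      ext y
      simp
    rw [hempty, AddSubgroup.closure_empty, AddSubgroup.mem_bot] at hx
    rw [hx]
    exact KZ.relations.zero_mem
  | succ E ih =>
    intro x hx hx0
    obtain ⟨H, hH, k, m, p, q, b, d, ρ, P, k₂, d₂, m₂, R, r₀, g, hP, hR, hHeq, hfib⟩ :=
      hRL (E + 1) x hx hx0
    -- the elementary clauses without the grading
    have hP' : ∀ i, 0 < q i ∧ p i < q i ∧ (0 < p i ∨ 0 < b i) ∧ (P i).domain = {z | ∃ (s u : ℝ) (y : Fin (b i) → ℝ) (w : Fin (d i) → ℝ), z = Matrix.vecCons s (Matrix.vecCons u (Fin.append y w)) ∧ 0 < s ∧ s < 1 ∧ 0 < u ∧ u ^ (q i) * s ^ (p i) < 1 ∧ (∀ j, s ≤ y j ∧ y j ≤ 1) ∧ w ∈ (ρ i).domain} ∧ (P i).integrand = fun z => (∏ j : Fin (b i), (z (Fin.castAdd (d i) j).succ.succ)⁻¹) * (ρ i).integrand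 (fun l : Fin (d i) => z (Fin.natAdd (b i) l).succ.succ) :=
      fun i => ⟨(hP i).1, (hP i).2.1, (hP i).2.2.1, (hP i).2.2.2.2⟩
    -- S2: the slices of the divergent part vanish identically on `(0,1)`
    have hvan : ∀ s ∈ Set.Ioo (0 : ℝ) 1, KZ.sliceEval (∑ i, m i • KZ.of (P i)) s = 0 :=
      stub_divergentNetVanishes_of stub_sliceValue_elementaryFamily stub_divergentMonomials_coeff_eq_zero
        H hH k m p q b d ρ P k₂ d₂ m₂ R r₀ g (fun i => ⟨(hP i).1, (hP i).2.2.1, (hP i).2.2.2.2⟩) hR hHeq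
    -- the coefficient classes have value zero and live one level down: relations by the IH
    have hcoef : ∀ i₀ : Fin k, (∑ i ∈ Finset.univ.filter
        (fun i => (p i / q i : ℝ) = (p i₀ / q i₀ : ℝ) ∧ b i = b i₀), m i • KZ.of (ρ i)) ∈ KZ.relations := by
      intro i₀
      refine ih _ ?_ (stub_eval_coefficientClass_eq_zero k m p q b d ρ P hP' hvan i₀)
      refine AddSubgroup.sum_mem _ fun i _ => AddSubgroup.zsmul_mem _ (AddSubgroup.subset_closure ?_) _
      exact ⟨d i, ρ i, by have := (hP i).2.2.2.1; omega, rfl⟩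
    -- S3a: the divergent part is a fibred relation
    have hD : (∑ i, m i • KZ.of (P i)) ∈ KZ.fibredRelations :=
      stub_elementaryNet_mem_fibredRelations k m p q b d ρ P hP' hcoef
    -- hence so is the dominated net `N = H - D`
    have hN : (∑ j, m₂ j • KZ.of (R j)) ∈ KZ.fibredRelations := by
      have hEq : (∑ j, m₂ j • KZ.of (R j)) = H - ∑ i, m i • KZ.of (P i) := by
        rw [hHeq]; abel
      rw [hEq]
      exact KZ.fibredRelations.sub_mem hH hD
    -- SF: its special-fibre class is a relation, and it is `≡ x`
    have h := KZ.relations.sub_mem (hSF k₂ d₂ m₂ R r₀ g hR hN) hfib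
    rwa [sub_sub_cancel] at h

/-- **RLG ∧ SF ⇒ `KZKernelConjecture`**: every formal combination lies on some level
(`stub_exists_dimBound`), where `kzKernel_dimLevel_of_regLiftGraded_of_specialFibre` applies.
[Kontsevich–Zagier 2001, §1.2 Conjecture 1; Huber–Müller-Stach 2017, Conj. 13.2.1] [folklore] -/
theorem kzKernelConjecture_of_regLiftGraded_of_specialFibre
    (hRL : ∀ (E : ℕ) (x : KZ.FormalRep), x ∈ AddSubgroup.closure {y : KZ.FormalRep | ∃ (n : ℕ) (r : KZ.IntegralRep n), n < E ∧ y = KZ.of r} → KZ.eval x = 0 → ∃ H ∈ KZ.fibredRelations, ∃ (k : ℕ) (m : Fin k → ℤ) (p q b d : Fin k → ℕ) (ρ : (i : Fin k) → KZ.IntegralRep (d i)) (P : (i : Fin k) → KZ.IntegralRep (b i + d i + 1 + 1)) (k₂ : ℕ) (d₂ : Fin k₂ → ℕ) (m₂ : Fin k₂ → ℤ) (R : (j : Fin k₂) → KZ.IntegralRep (d₂ j + 1)) (r₀ g : (j : Fin k₂) → KZ.IntegralRep (d₂ j)), (∀ i, 0 < q i ∧ p i < q i ∧ (0 < p i ∨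 0 < b i) ∧ d i + 1 < E ∧ (P i).domain = {z | ∃ (s u : ℝ) (y : Fin (b i) → ℝ) (w : Fin (d i) → ℝ), z = Matrix.vecCons s (Matrix.vecCons u (Fin.append y w)) ∧ 0 < s ∧ s < 1 ∧ 0 < u ∧ u ^ (q i) * s ^ (p i) < 1 ∧ (∀ j, s ≤ y j ∧ y j ≤ 1) ∧ w ∈ (ρ i).domain} ∧ (P i).integrand = fun z => (∏ j : Fin (b i), (z (Fin.castAdd (d i) j).succ.succ)⁻¹) * (ρ i).integrand (fun l : Fin (d i) => z (Fin.natAdd (b i) l).succ.succ)) ∧ (∀ j, KZ.IsDominatedFamily (R j) (r₀ j) (g j)) ∧ H = (∑ i, m i • KZ.of (P i)) + (∑ j, m₂ j • KZ.of (R j)) ∧ (∑ j, m₂ j • KZ.of (r₀ j)) - x ∈ KZ.relations)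
    (hSF : ∀ (k : ℕ) (d : Fin k → ℕ) (m : Fin k → ℤ) (R : (i : Fin k) → KZ.IntegralRep (d i + 1)) (r₀ g : (i : Fin k) → KZ.IntegralRep (d i)), (∀ i, KZ.IsDominatedFamily (R i) (r₀ i) (g i)) → (∑ i, m i • KZ.of (R i)) ∈ KZ.fibredRelations → (∑ i, m i • KZ.of (r₀ i)) ∈ KZ.relations) :
    KZKernelConjecture := by
  intro x hx
  obtain ⟨E, hE⟩ := stub_exists_dimBound x
  exact kzKernel_dimLevel_of_regLiftGraded_of_specialFibre hRL hSF E x hE hx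

/-- **RLG ∧ SF ⇒ the summit** (`kzKernelConjecture_iff_isRational`).
[Kontsevich–Zagier 2001, §1.2 Conjecture 1] [folklore] -/
theorem kontsevichZagierPeriods_of_regLiftGraded_of_specialFibre
    (hRL : ∀ (E : ℕ) (x : KZ.FormalRep), x ∈ AddSubgroup.closure {y : KZ.FormalRep | ∃ (n : ℕ) (r : KZ.IntegralRep n), n < E ∧ y = KZ.of r} → KZ.eval x = 0 → ∃ H ∈ KZ.fibredRelations, ∃ (k : ℕ) (m : Fin k → ℤ) (p q b d : Fin k → ℕ) (ρ : (i : Fin k) → KZ.IntegralRep (d i)) (P : (i : Fin k) → KZ.IntegralRep (b i + d i + 1 + 1)) (k₂ : ℕ) (d₂ : Fin k₂ → ℕ) (m₂ : Fin k₂ → ℤ) (R : (j : Fin k₂) → KZ.IntegralRep (d₂ j + 1)) (r₀ g : (j : Fin k₂) → KZ.IntegralRep (d₂ j)), (∀ i, 0 < q i ∧ p i < q i ∧ (0 < p i ∨ 0 < b i) ∧ d i + 1 < E ∧ (P i).domain = {z | ∃ (s u : ℝ) (y : Fin (b i) → ℝ) (w : Fin (d i) → ℝ), z = Matrix.vecCons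 s (Matrix.vecCons u (Fin.append y w)) ∧ 0 < s ∧ s < 1 ∧ 0 < u ∧ u ^ (q i) * s ^ (p i) < 1 ∧ (∀ j, s ≤ y j ∧ y j ≤ 1) ∧ w ∈ (ρ i).domain} ∧ (P i).integrand = fun z => (∏ j : Fin (b i), (z (Fin.castAdd (d i) j).succ.succ)⁻¹) * (ρ i).integrand (fun l : Fin (d i) => z (Fin.natAdd (b i) l).succ.succ)) ∧ (∀ j, KZ.IsDominatedFamily (R j) (r₀ j) (g j)) ∧ H = (∑ i, m i • KZ.of (P i)) + (∑ j, m₂ j • KZ.of (R j)) ∧ (∑ j, m₂ j • KZ.of (r₀ j)) - x ∈ KZ.relations)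
    (hSF : ∀ (k : ℕ) (d : Fin k → ℕ) (m : Fin k → ℤ) (R : (i : Fin k) → KZ.IntegralRep (d i + 1)) (r₀ g : (i : Fin k) → KZ.IntegralRep (d i)), (∀ i, KZ.IsDominatedFamily (R i) (r₀ i) (g i)) → (∑ i, m i • KZ.of (R i)) ∈ KZ.fibredRelations → (∑ i, m i • KZ.of (r₀ i)) ∈ KZ.relations) :
    KontsevichZagierPeriods :=
  kzKernelConjecture_iff_isRational.mp (kzKernelConjecture_of_regLiftGraded_of_specialFibre hRL hSF)

/-- **RLG ∧ SF ⇒ `ParametricLifting`** (the crux of this line, via the summit with `G := 0`,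
`parametricLifting_of_kzKernelConjecture`). [Kontsevich–Zagier 2001, §1.2 Conjecture 1] [folklore] -/
theorem parametricLifting_of_regLiftGraded_of_specialFibre
    (hRL : ∀ (E : ℕ) (x : KZ.FormalRep), x ∈ AddSubgroup.closure {y : KZ.FormalRep | ∃ (n : ℕ) (r : KZ.IntegralRep n), n < E ∧ y = KZ.of r} → KZ.eval x = 0 → ∃ H ∈ KZ.fibredRelations, ∃ (k : ℕ) (m : Fin k → ℤ) (p q b d : Fin k → ℕ) (ρ : (i : Fin k) → KZ.IntegralRep (d i)) (P : (i : Fin k) → KZ.IntegralRep (b i + d i + 1 + 1)) (k₂ : ℕ) (d₂ : Fin k₂ → ℕ) (m₂ : Fin k₂ → ℤ) (R : (j : Fin k₂) → KZ.IntegralRep (d₂ j + 1)) (r₀ g : (j : Fin k₂) → KZ.IntegralRep (d₂ j)), (∀ i, 0 < q i ∧ p i < q i ∧ (0 < p i ∨ 0 < b i) ∧ d i + 1 < E ∧ (P i).domain = {z | ∃ (s u : ℝ) (y : Fin (b i) → ℝ) (w : Fin (d i) → ℝ), z = Matrix.vecCons s (Matrix.vecCons u (Fin.append y w)) ∧ 0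 < s ∧ s < 1 ∧ 0 < u ∧ u ^ (q i) * s ^ (p i) < 1 ∧ (∀ j, s ≤ y j ∧ y j ≤ 1) ∧ w ∈ (ρ i).domain} ∧ (P i).integrand = fun z => (∏ j : Fin (b i), (z (Fin.castAdd (d i) j).succ.succ)⁻¹) * (ρ i).integrand (fun l : Fin (d i) => z (Fin.natAdd (b i) l).succ.succ)) ∧ (∀ j, KZ.IsDominatedFamily (R j) (r₀ j) (g j)) ∧ H = (∑ i, m i • KZ.of (P i)) + (∑ j, m₂ j • KZ.of (R j)) ∧ (∑ j, m₂ j • KZ.of (r₀ j)) - x ∈ KZ.relations)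
    (hSF : ∀ (k : ℕ) (d : Fin k → ℕ) (m : Fin k → ℤ) (R : (i : Fin k) → KZ.IntegralRep (d i + 1)) (r₀ g : (i : Fin k) → KZ.IntegralRep (d i)), (∀ i, KZ.IsDominatedFamily (R i) (r₀ i) (g i)) → (∑ i, m i • KZ.of (R i)) ∈ KZ.fibredRelations → (∑ i, m i • KZ.of (r₀ i)) ∈ KZ.relations) :
    ParametricLifting :=
  parametricLifting_of_kzKernelConjecture (kzKernelConjecture_of_regLiftGraded_of_specialFibre hRL hSF)

/-- **The route's assembly with the weaker open core: `CTConstruction` ∧ RLG ⇒ summit.**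
`CTConstruction` delivers SF (`specialFibre_of_ctConstruction`: CT2 sends the fibred subgroup into
relations, CT3 sends dominated families to their special fibres), and RLG ∧ SF give the summit by the
graded bootstrap. Compared with the route file's `closes : CTConstruction → ParametricLifting → summit`,
the exactness demand on the regularised net (no divergent counterterms) is replaced by "divergent
counterterms are elementary with coefficients one dimension down", which is what regularised identities
supply. [Kontsevich–Zagier 2001, §1.2 Conjecture 1] [folklore] -/
theorem kontsevichZagierPeriods_of_ctConstruction_of_regLiftGraded (hCT : CTConstruction)
    (hRL : ∀ (E : ℕ) (x : KZ.FormalRep), x ∈ AddSubgroup.closure {y : KZ.FormalRep | ∃ (n : ℕ) (r : KZ.IntegralRep n), n < E ∧ y = KZ.of r} → KZ.eval x = 0 → ∃ H ∈ KZ.fibredRelations, ∃ (k : ℕ) (m : Fin k → ℤ) (p q b d : Fin k → ℕ) (ρ : (i : Fin k) → KZ.IntegralRep (d i)) (P : (i : Fin k) → KZ.IntegralRep (b i + d i + 1 + 1)) (k₂ : ℕ) (d₂ : Fin k₂ → ℕ) (m₂ : Fin k₂ → ℤ) (R : (j : Fin k₂) → KZ.IntegralRep (d₂ j + 1)) (r₀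 g : (j : Fin k₂) → KZ.IntegralRep (d₂ j)), (∀ i, 0 < q i ∧ p i < q i ∧ (0 < p i ∨ 0 < b i) ∧ d i + 1 < E ∧ (P i).domain = {z | ∃ (s u : ℝ) (y : Fin (b i) → ℝ) (w : Fin (d i) → ℝ), z = Matrix.vecCons s (Matrix.vecCons u (Fin.append y w)) ∧ 0 < s ∧ s < 1 ∧ 0 < u ∧ u ^ (q i) * s ^ (p i) < 1 ∧ (∀ j, s ≤ y j ∧ y j ≤ 1) ∧ w ∈ (ρ i).domain} ∧ (P i).integrand = fun z => (∏ j : Fin (b i), (z (Fin.castAdd (d i) j).succ.succ)⁻¹) * (ρ i).integrand (fun l : Fin (d i) => z (Fin.natAdd (b i) l).succ.succ)) ∧ (∀ j, KZ.IsDominatedFamily (R j) (r₀ j) (g j)) ∧ H = (∑ i, m i • KZ.of (P i)) + (∑ j, m₂ j • KZ.of (R j)) ∧ (∑ j, m₂ j • KZ.of (r₀ j)) - x ∈ KZ.relations) :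
    KontsevichZagierPeriods :=
  kontsevichZagierPeriods_of_regLiftGraded_of_specialFibre hRL (specialFibre_of_ctConstruction hCT)

/-! ### Strength of RLG: between `ParametricLifting` and (with SF) the summit -/

/-- **`ParametricLifting` ⇒ RLG** (RLG is the WEAKER open core): by the kernel form of PL
(`parametricLifting_iff_kernelForm`) every `x ∈ ker eval` — on whatever level — is the special fibre of
an EXACT dominated fibred net; take the empty divergent part. [Kontsevich–Zagier 2001, §1.2 Conjecture 1]
[folklore] -/
theorem regLiftGraded_of_parametricLifting (hPL : ParametricLifting) :
    ∀ (E : ℕ) (x : KZ.FormalRep), x ∈ AddSubgroup.closure {y : KZ.FormalRep | ∃ (n : ℕ) (r : KZ.IntegralRep n), n < E ∧ y = KZ.of r} → KZ.eval x = 0 → ∃ H ∈ KZ.fibredRelations, ∃ (k : ℕ) (m : Fin k → ℤ) (p q b d : Fin k → ℕ) (ρ : (i : Fin k) → KZ.IntegralRep (d i)) (P : (i : Fin k) → KZ.IntegralRep (b i + d i + 1 + 1)) (k₂ : ℕ) (d₂ : Fin k₂ → ℕ) (m₂ : Fin k₂ → ℤ) (R : (j : Fin k₂) → KZ.IntegralRep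 (d₂ j + 1)) (r₀ g : (j : Fin k₂) → KZ.IntegralRep (d₂ j)), (∀ i, 0 < q i ∧ p i < q i ∧ (0 < p i ∨ 0 < b i) ∧ d i + 1 < E ∧ (P i).domain = {z | ∃ (s u : ℝ) (y : Fin (b i) → ℝ) (w : Fin (d i) → ℝ), z = Matrix.vecCons s (Matrix.vecCons u (Fin.append y w)) ∧ 0 < s ∧ s < 1 ∧ 0 < u ∧ u ^ (q i) * s ^ (p i) < 1 ∧ (∀ j, s ≤ y j ∧ y j ≤ 1) ∧ w ∈ (ρ i).domain} ∧ (P i).integrand = fun z => (∏ j : Fin (b i), (z (Fin.castAdd (d i) j).succ.succ)⁻¹) * (ρ i).integrand (fun l : Fin (d i) => z (Fin.natAdd (b i) l).succ.succ)) ∧ (∀ j, KZ.IsDominatedFamily (R j) (r₀ j) (g j)) ∧ H = (∑ i, m i • KZ.of (P i)) + (∑ j, m₂ j • KZ.of (R j)) ∧ (∑ j, m₂ j • KZ.of (r₀ j)) - x ∈ KZ.relations := by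
  intro E x _ hx
  obtain ⟨k, d, m, R, r₀, g, hdom, hG, hfib⟩ := parametricLifting_iff_kernelForm.mp hPL x hx
  refine ⟨∑ i, m i • KZ.of (R i), hG, 0, Fin.elim0, Fin.elim0, Fin.elim0, Fin.elim0, Fin.elim0,
    fun i => i.elim0, fun i => i.elim0, k, d, m, R, r₀, g, fun i => i.elim0, hdom, by simp, hfib⟩

/-- **`KZKernelConjecture` ⇒ RLG** (take `H = 0`, empty data: `−x ∈ KZ.relations`).
[Kontsevich–Zagier 2001, §1.2 Conjecture 1] [folklore] -/
theorem regLiftGraded_of_kzKernelConjecture (hK : KZKernelConjecture) :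
    ∀ (E : ℕ) (x : KZ.FormalRep), x ∈ AddSubgroup.closure {y : KZ.FormalRep | ∃ (n : ℕ) (r : KZ.IntegralRep n), n < E ∧ y = KZ.of r} → KZ.eval x = 0 → ∃ H ∈ KZ.fibredRelations, ∃ (k : ℕ) (m : Fin k → ℤ) (p q b d : Fin k → ℕ) (ρ : (i : Fin k) → KZ.IntegralRep (d i)) (P : (i : Fin k) → KZ.IntegralRep (b i + d i + 1 + 1)) (k₂ : ℕ) (d₂ : Fin k₂ → ℕ) (m₂ : Fin k₂ → ℤ) (R : (j : Fin k₂) → KZ.IntegralRep (d₂ j + 1)) (r₀ g : (j : Fin k₂) → KZ.IntegralRep (d₂ j)), (∀ i, 0 < q i ∧ p i < q i ∧ (0 < p i ∨ 0 < b i) ∧ d i + 1 < E ∧ (P i).domain = {z | ∃ (s u : ℝ) (y : Fin (b i) → ℝ) (w : Fin (d i) → ℝ), z = Matrix.vecCons s (Matrix.vecCons u (Fin.append y w)) ∧ 0 < s ∧ s < 1 ∧ 0 < u ∧ u ^ (q i) * s ^ (p i) < 1 ∧ (∀ j, s ≤ y j ∧ y j ≤ 1) ∧ w ∈ (ρ i).domain}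 ∧ (P i).integrand = fun z => (∏ j : Fin (b i), (z (Fin.castAdd (d i) j).succ.succ)⁻¹) * (ρ i).integrand (fun l : Fin (d i) => z (Fin.natAdd (b i) l).succ.succ)) ∧ (∀ j, KZ.IsDominatedFamily (R j) (r₀ j) (g j)) ∧ H = (∑ i, m i • KZ.of (P i)) + (∑ j, m₂ j • KZ.of (R j)) ∧ (∑ j, m₂ j • KZ.of (r₀ j)) - x ∈ KZ.relations :=
  regLiftGraded_of_parametricLifting (parametricLifting_of_kzKernelConjecture hK)

/-- **`KZKernelConjecture` ⇔ RLG ∧ SF** — the graded twin of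
`kzKernelConjecture_iff_kernelForm_and_specialFibre`: the kernel conjecture splits losslessly into the
graded regularised lifting and special-fibre rigidity, each a consequence of it
(`regLiftGraded_of_kzKernelConjecture`, `specialFibre_of_kzKernelConjecture`), jointly giving it back
(`kzKernelConjecture_of_regLiftGraded_of_specialFibre`). [Kontsevich–Zagier 2001, §1.2 Conjecture 1;
Huber–Müller-Stach 2017, Conj. 13.2.1] [folklore] -/
theorem kzKernelConjecture_iff_regLiftGraded_and_specialFibre :
    KZKernelConjecture ↔
      (∀ (E : ℕ) (x : KZ.FormalRep), x ∈ AddSubgroup.closure {y : KZ.FormalRep | ∃ (n : ℕ) (r : KZ.IntegralRep n), n < E ∧ y = KZ.of r} → KZ.eval x = 0 → ∃ H ∈ KZ.fibredRelations, ∃ (k : ℕ) (m : Fin k → ℤ) (p q b d : Fin k → ℕ) (ρ : (i : Fin k) → KZ.IntegralRep (d i)) (P : (i : Fin k) → KZ.IntegralRep (b i + d i + 1 + 1)) (k₂ : ℕ) (d₂ : Fin k₂ → ℕ) (m₂ : Fin k₂ → ℤ) (R : (j : Fin k₂) → KZ.IntegralRep (d₂ j + 1)) (r₀ g : (j : Fin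 k₂) → KZ.IntegralRep (d₂ j)), (∀ i, 0 < q i ∧ p i < q i ∧ (0 < p i ∨ 0 < b i) ∧ d i + 1 < E ∧ (P i).domain = {z | ∃ (s u : ℝ) (y : Fin (b i) → ℝ) (w : Fin (d i) → ℝ), z = Matrix.vecCons s (Matrix.vecCons u (Fin.append y w)) ∧ 0 < s ∧ s < 1 ∧ 0 < u ∧ u ^ (q i) * s ^ (p i) < 1 ∧ (∀ j, s ≤ y j ∧ y j ≤ 1) ∧ w ∈ (ρ i).domain} ∧ (P i).integrand = fun z => (∏ j : Fin (b i), (z (Fin.castAdd (d i) j).succ.succ)⁻¹) * (ρ i).integrand (fun l : Fin (d i) => z (Fin.natAdd (b i) l).succ.succ)) ∧ (∀ j, KZ.IsDominatedFamily (R j) (r₀ j) (g j)) ∧ H = (∑ i, m i • KZ.of (P i)) + (∑ j, m₂ j • KZ.of (R j)) ∧ (∑ j, m₂ j • KZ.of (r₀ j)) - x ∈ KZ.relations) ∧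
      ∀ (k : ℕ) (d : Fin k → ℕ) (m : Fin k → ℤ) (R : (i : Fin k) → KZ.IntegralRep (d i + 1)) (r₀ g : (i : Fin k) → KZ.IntegralRep (d i)), (∀ i, KZ.IsDominatedFamily (R i) (r₀ i) (g i)) → (∑ i, m i • KZ.of (R i)) ∈ KZ.fibredRelations → (∑ i, m i • KZ.of (r₀ i)) ∈ KZ.relations :=
  ⟨fun h => ⟨regLiftGraded_of_kzKernelConjecture h, specialFibre_of_kzKernelConjecture h⟩,
    fun h => kzKernelConjecture_of_regLiftGraded_of_specialFibre h.1 h.2⟩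

/-- **Summit ⇔ RLG ∧ SF** (through `kzKernelConjecture_iff_isRational`). [Kontsevich–Zagier 2001, §1.2
Conjecture 1] [folklore] -/
theorem kontsevichZagierPeriods_iff_regLiftGraded_and_specialFibre :
    KontsevichZagierPeriods ↔
      (∀ (E : ℕ) (x : KZ.FormalRep), x ∈ AddSubgroup.closure {y : KZ.FormalRep | ∃ (n : ℕ) (r : KZ.IntegralRep n), n < E ∧ y = KZ.of r} → KZ.eval x = 0 → ∃ H ∈ KZ.fibredRelations, ∃ (k : ℕ) (m : Fin k → ℤ) (p q b d : Fin k → ℕ) (ρ : (i : Fin k) → KZ.IntegralRep (d i)) (P : (i : Fin k) → KZ.IntegralRep (b i + d i + 1 + 1)) (k₂ : ℕ) (d₂ : Fin k₂ → ℕ) (m₂ : Fin k₂ → ℤ) (R : (j : Fin k₂) → KZ.IntegralRep (d₂ j + 1)) (r₀ g : (j : Fin k₂) → KZ.IntegralRep (d₂ j)), (∀ i, 0 < q i ∧ p i < q i ∧ (0 < p i ∨ 0 < b i) ∧ d i + 1 < E ∧ (P i).domain = {z | ∃ (s u : ℝ) (y : Fin (b i) → ℝ) (w : Fin (d i) → ℝ),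 z = Matrix.vecCons s (Matrix.vecCons u (Fin.append y w)) ∧ 0 < s ∧ s < 1 ∧ 0 < u ∧ u ^ (q i) * s ^ (p i) < 1 ∧ (∀ j, s ≤ y j ∧ y j ≤ 1) ∧ w ∈ (ρ i).domain} ∧ (P i).integrand = fun z => (∏ j : Fin (b i), (z (Fin.castAdd (d i) j).succ.succ)⁻¹) * (ρ i).integrand (fun l : Fin (d i) => z (Fin.natAdd (b i) l).succ.succ)) ∧ (∀ j, KZ.IsDominatedFamily (R j) (r₀ j) (g j)) ∧ H = (∑ i, m i • KZ.of (P i)) + (∑ j, m₂ j • KZ.of (R j)) ∧ (∑ j, m₂ j • KZ.of (r₀ j)) - x ∈ KZ.relations) ∧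
      ∀ (k : ℕ) (d : Fin k → ℕ) (m : Fin k → ℤ) (R : (i : Fin k) → KZ.IntegralRep (d i + 1)) (r₀ g : (i : Fin k) → KZ.IntegralRep (d i)), (∀ i, KZ.IsDominatedFamily (R i) (r₀ i) (g i)) → (∑ i, m i • KZ.of (R i)) ∈ KZ.fibredRelations → (∑ i, m i • KZ.of (r₀ i)) ∈ KZ.relations :=
  kzKernelConjecture_iff_isRational.symm.trans kzKernelConjecture_iff_regLiftGraded_and_specialFibre

/-! ### Calibration: the open content of RLG starts at level 2 -/

/-- **RLG holds unconditionally on levels `E ≤ 1`.** Level `≤ 1` is generated by the constants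
(`0`-dimensional representations), on which the kernel conjecture is a theorem (`dimZero_kernel`: every
constant combination is one constant `[pt, a]` with `a = eval`); so `x ∈ KZ.relations` already and the
EMPTY net (`H = 0`) certifies it. The first open level is `E = 2` (combinations of one-dimensional
representations — logarithms and algebraic numbers, Baker-type input).
[Kontsevich–Zagier 2001, §1.1–1.2] [folklore] -/
theorem regLiftGraded_of_le_one :
    ∀ (E : ℕ), E ≤ 1 → ∀ (x : KZ.FormalRep), x ∈ AddSubgroup.closure {y : KZ.FormalRep | ∃ (n : ℕ) (r : KZ.IntegralRep n), n < E ∧ y = KZ.of r} → KZ.eval x = 0 → ∃ H ∈ KZ.fibredRelations, ∃ (k : ℕ) (m : Fin k → ℤ) (p q b d : Fin k → ℕ) (ρ : (i : Fin k) → KZ.IntegralRep (d i)) (P : (i : Fin k) → KZ.IntegralRep (b i + d i + 1 + 1)) (k₂ : ℕ) (d₂ : Fin k₂ → ℕ) (m₂ : Fin k₂ → ℤ) (R : (j : Fin k₂) → KZ.IntegralRep (d₂ j + 1)) (r₀ g : (j : Fin k₂) → KZ.IntegralRep (d₂ j)), (∀ i, 0 < q i ∧ p i < q i ∧ (0 <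 p i ∨ 0 < b i) ∧ d i + 1 < E ∧ (P i).domain = {z | ∃ (s u : ℝ) (y : Fin (b i) → ℝ) (w : Fin (d i) → ℝ), z = Matrix.vecCons s (Matrix.vecCons u (Fin.append y w)) ∧ 0 < s ∧ s < 1 ∧ 0 < u ∧ u ^ (q i) * s ^ (p i) < 1 ∧ (∀ j, s ≤ y j ∧ y j ≤ 1) ∧ w ∈ (ρ i).domain} ∧ (P i).integrand = fun z => (∏ j : Fin (b i), (z (Fin.castAdd (d i) j).succ.succ)⁻¹) * (ρ i).integrand (fun l : Fin (d i) => z (Fin.natAdd (b i) l).succ.succ)) ∧ (∀ j, KZ.IsDominatedFamily (R j) (r₀ j) (g j)) ∧ H = (∑ i, m i • KZ.of (P i)) + (∑ j, m₂ j • KZ.of (R j)) ∧ (∑ j, m₂ j • KZ.of (r₀ j)) - x ∈ KZ.relations := by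
  intro E hE x hx hx0
  -- level `≤ 1` is inside the constants
  have hx' : x ∈ AddSubgroup.closure (Set.range fun r : KZ.IntegralRep 0 => KZ.of r) := by
    refine AddSubgroup.closure_mono ?_ hx
    rintro _ ⟨n, r, hn, rfl⟩
    obtain rfl : n = 0 := by omega
    exact ⟨r, rfl⟩
  have hrel : x ∈ KZ.relations :=
    Summit.KontsevichZagierPeriods.KontsevichZagierPeriods.ReducedPeriodRingNegative.dimZero_kernel hx' hx0
  refine ⟨0, KZ.fibredRelations.zero_mem, 0, Fin.elim0, Fin.elim0, Fin.elim0, Fin.elim0, Fin.elim0,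
    fun i => i.elim0, fun i => i.elim0, 0, Fin.elim0, Fin.elim0, fun j => j.elim0, fun j => j.elim0,
    fun j => j.elim0, fun i => i.elim0, fun j => j.elim0, by simp, ?_⟩
  simp only [Finset.univ_eq_empty, Finset.sum_empty, zero_sub]
  exact KZ.relations.neg_mem hrel

/-! ### Registered sub-goal forms (one-line Prop signatures, `ledger workitem stub-add`) -/

/-- **RLG → SF → `KZKernelConjecture`** — `kzKernelConjecture_of_regLiftGraded_of_specialFibre` in the
one-line registered form (sub-goal `gradedBootstrap_kzKernelConjecture` of stmt-KontsevichZagierPeriods-3498).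
[Kontsevich–Zagier 2001, §1.2 Conjecture 1] [folklore] -/
theorem gradedBootstrap_kzKernelConjecture : (∀ (E : ℕ) (x : KZ.FormalRep), x ∈ AddSubgroup.closure {y : KZ.FormalRep | ∃ (n : ℕ) (r : KZ.IntegralRep n), n < E ∧ y = KZ.of r} → KZ.eval x = 0 → ∃ H ∈ KZ.fibredRelations, ∃ (k : ℕ) (m : Fin k → ℤ) (p q b d : Fin k → ℕ) (ρ : (i : Fin k) → KZ.IntegralRep (d i)) (P : (i : Fin k) → KZ.IntegralRep (b i + d i + 1 + 1)) (k₂ : ℕ) (d₂ : Fin k₂ → ℕ) (m₂ : Fin k₂ → ℤ) (R : (j : Fin k₂) → KZ.IntegralRep (d₂ j + 1)) (r₀ g : (j : Fin k₂) → KZ.IntegralRep (d₂ j)), (∀ i, 0 < q i ∧ p i < q i ∧ (0 < p i ∨ 0 < b i) ∧ d i + 1 < E ∧ (P i).domain = {z | ∃ (s u : ℝ) (y : Fin (b i) → ℝ) (w : Fin (d i) → ℝ), z = Matrix.vecCons s (Matrix.vecCons u (Fin.append y w)) ∧ 0 < s ∧ s < 1 ∧ 0 < u ∧ u ^ (q i)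 * s ^ (p i) < 1 ∧ (∀ j, s ≤ y j ∧ y j ≤ 1) ∧ w ∈ (ρ i).domain} ∧ (P i).integrand = fun z => (∏ j : Fin (b i), (z (Fin.castAdd (d i) j).succ.succ)⁻¹) * (ρ i).integrand (fun l : Fin (d i) => z (Fin.natAdd (b i) l).succ.succ)) ∧ (∀ j, KZ.IsDominatedFamily (R j) (r₀ j) (g j)) ∧ H = (∑ i, m i • KZ.of (P i)) + (∑ j, m₂ j • KZ.of (R j)) ∧ (∑ j, m₂ j • KZ.of (r₀ j)) - x ∈ KZ.relations) → (∀ (k : ℕ) (d : Fin k → ℕ) (m : Fin k → ℤ) (R : (i : Fin k) → KZ.IntegralRep (d i + 1)) (r₀ g : (i : Fin k) → KZ.IntegralRep (d i)), (∀ i, KZ.IsDominatedFamily (R i) (r₀ i) (g i)) → (∑ i, m i • KZ.of (R i)) ∈ KZ.fibredRelations → (∑ i, m i • KZ.of (r₀ i)) ∈ KZ.relations) → KZKernelConjecture :=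
  fun hRL hSF => kzKernelConjecture_of_regLiftGraded_of_specialFibre hRL hSF

/-- **`CTConstruction` → RLG → summit** — `kontsevichZagierPeriods_of_ctConstruction_of_regLiftGraded` in
the one-line registered form (sub-goal `gradedBootstrap_assembly` of stmt-KontsevichZagierPeriods-3498): the
route's assembly with the open core weakened from `ParametricLifting` to the graded regularised lifting.
[Kontsevich–Zagier 2001, §1.2 Conjecture 1] [folklore] -/
theorem gradedBootstrap_assembly : Summit.KontsevichZagierPeriods.KontsevichZagierPeriods.Theses.ValuedFieldSpecialisation.CTConstruction → (∀ (E : ℕ) (x : KZ.FormalRep), x ∈ AddSubgroup.closure {y : KZ.FormalRep | ∃ (n : ℕ) (r : KZ.IntegralRep n), n < E ∧ y = KZ.of r} → KZ.eval x = 0 → ∃ H ∈ KZ.fibredRelations, ∃ (k : ℕ) (m : Fin k → ℤ) (p q b d : Fin k → ℕ) (ρ : (i : Fin k) → KZ.IntegralRep (d i)) (P : (i : Fin k) → KZ.IntegralRep (b i + d i + 1 + 1)) (k₂ : ℕ) (d₂ : Fin k₂ → ℕ) (m₂ : Fin k₂ → ℤ) (R : (j : Fin k₂) → KZ.IntegralRep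 (d₂ j + 1)) (r₀ g : (j : Fin k₂) → KZ.IntegralRep (d₂ j)), (∀ i, 0 < q i ∧ p i < q i ∧ (0 < p i ∨ 0 < b i) ∧ d i + 1 < E ∧ (P i).domain = {z | ∃ (s u : ℝ) (y : Fin (b i) → ℝ) (w : Fin (d i) → ℝ), z = Matrix.vecCons s (Matrix.vecCons u (Fin.append y w)) ∧ 0 < s ∧ s < 1 ∧ 0 < u ∧ u ^ (q i) * s ^ (p i) < 1 ∧ (∀ j, s ≤ y j ∧ y j ≤ 1) ∧ w ∈ (ρ i).domain} ∧ (P i).integrand = fun z => (∏ j : Fin (b i), (z (Fin.castAdd (d i) j).succ.succ)⁻¹) * (ρ i).integrand (fun l : Fin (d i) => z (Fin.natAdd (b i) l).succ.succ)) ∧ (∀ j, KZ.IsDominatedFamily (R j) (r₀ j) (g j)) ∧ H = (∑ i, m i • KZ.of (P i)) + (∑ j, m₂ j • KZ.of (R j)) ∧ (∑ j, m₂ j • KZ.of (r₀ j)) - x ∈ KZ.relations) → KontsevichZagierPeriods :=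
  fun hCT hRL => kontsevichZagierPeriods_of_ctConstruction_of_regLiftGraded hCT hRL

end Summit.KontsevichZagierPeriods.ValuedFieldSpecialisation
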